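import Summits.QuantumFields.YangMills.Theorems.SwapVirialDeficitGnomonicSpeed
import Summits.QuantumFields.YangMills.Theorems.SwapVirialDeficitBlowUpQuatDeficit
import Summits.QuantumFields.YangMills.Theorems.LuscherReductionTwistedTraceScalingSliceSmooth
import Mathlib.Analysis.InnerProductSpace.Calculus
import HarnessLib

/-!
# The SPEED of the σ-glued deficit along a moving quaternion history (brick S-B, part 3a, of fcl-p3 g45's virial SPEC): if every link and seam
# quaternion has norm `≤ 1` and speed `≤ M`, then `|d/ds qDeficit| ≤ 108·M·L⁴`
# (free-hands support of ⟨stmt-QuantumFields-24197⟩ `SwapVirialDeficit.SwapGluedStiffness`)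

Sequel of ✓`…GnomonicSpeed` (letters `≤ 1/2`, words add speeds) and ✓`…GnomonicSpeedLeaders` (leaders `≤ 1`): the ring-level bookkeeping, GENERIC
over a moving quaternion history `Q : ℝ → (Fin (2L−1+1) → Edge 3 L → ℍ) × (Site 3 L → ℍ)` (no chart, no blow-up — instantiate with the gnomonic
blow-up path, where every link is a word of `≤ 3` letters, `M = 3`):

* §1 `hasDerivAt_re` (`re = ⟨·, 1⟩`, `HasDerivAt.inner`), conjugates through ✓`ConstTube.star_eq_two_re` (`q̄ = 2re(q)·1 − q`; no `StarModule ℝ ℍ` needed):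
  `hasDerivAt_star_norm_le`, `hasDerivAt_neg_norm_le`, `hasDerivAt_const_sub_mul_re` (`|d/ds (c − k·re w)| ≤ |k|·speed(w)`, ✓`abs_re_le_norm`);
* §2 ★ `hasDerivAt_qTimeCoupling` (`|d/ds Σ_e 2re(U_e V̄_e)| ≤ |Edge|·2(a + b)`), `hasDerivAt_qPlaq` (plaquette word: speed `≤ 4a`), ★ `hasDerivAt_qWilson`
  (`≤ |Plaquette|·8a`) — for links of norm `≤ 1` (✓`Gnomonic.exists_hasDerivAt_mul_norm_le`);
* §3 `hasDerivAt_qSeam` (the σ-glued seam links `g(x)·(±U₀(σe))·ḡ(x')`: norm `≤ 1`, speed `≤ 3M`) and ★★★ `hasDerivAt_qDeficit_le`: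
  `∃ d, HasDerivAt (fun s => qDeficit z (Q s)) d s ∧ |d| ≤ 108·M·L⁴` (coupling terms `≤ 12ML³` ∕ seam `24ML³`, Wilson half-sums `≤ 24ML³` ∕ seam `48ML³`,
  `2L − 1` slices; ✓`card_edge_three`, ✓`card_plaquette_three`).  With ✓`BlowUp.swapRingDeficit_eq_qDeficit` this is the bound `|X F̂| ≤ C_L = 324·L⁴`
  (hypothesis `hB₂` of ✓`Virial.integral_euler_deriv_mul_eq` ∕ the flow-derivative bound of ✓`Gnomonic.integral_flowDeriv_mul_piWeight`) once the link
  speeds `≤ 3` along `s ↦ blowUpPoint (e^s) (gnomonicPoint a ε η)` are plugged in (part 3b: the quantitative twin of ✓`contDiff_quatHistory_ringConfig`'s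
  word case split, with parts 1–2).

HONEST LABEL: calculus bookkeeping for the window programme of a DRAFT line; no estimate on ⟨24197⟩ (window-uniform, OPEN), ⟨24194⟩ ∕ ⟨24497⟩ OPEN; own crux
⟨22884⟩ OPEN (blocked-on ⟨19935⟩); no crux, rung of record or summit is proved; the Yang–Mills mass gap is NOT proved; no summit is proved by a line.  THEOREMS
ONLY (0 `def`, 0 `sorry`), standard axioms.  Width seat ym-line-sfw-p2-w2 g57 (cell ym-idea-1, free hands), `--supports stmt-QuantumFields-24197`.
References: [cite: Luscher1983, §2]; [folklore].
-/

set_option autoImplicit false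

noncomputable section

open Quaternion
open scoped Quaternion RealInnerProductSpace BigOperators
open Literature.MathematicalPhysics.QuantumLattice
open Literature.MathematicalPhysics.QuantumFieldTheory hiding SU2
open Summit.QuantumFields.YangMills.Theorems.SwapVirialDeficit.BlowUp (qTimeCoupling qPlaq qWilson qGauge qTwist3 qSwap qSeam qDeficit)

namespace Summit.QuantumFields.YangMills.Theorems.SwapVirialDeficit.Gnomonic

variable {L : ℕ} [NeZero L]

/-! ## §1 One-variable calculus of quaternion words: real part, conjugate, products -/

omit [NeZero L] in
/-- `d/ds re(f) = re(f')` (`re q = ⟨q, 1⟩`). [folklore] -/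
theorem hasDerivAt_re {f : ℝ → ℍ} {f' : ℍ} {s : ℝ} (h : HasDerivAt f f' s) : HasDerivAt (fun s => (f s).re) f'.re s := by
  have h1 := HasDerivAt.inner ℝ h (hasDerivAt_const s (1 : ℍ))
  simp only [inner_zero_right, zero_add, inner_one_right] at h1
  exact h1


omit [NeZero L] in
/-- `d/ds f̄ = f̄'` with the same norm bound. [folklore] -/
theorem hasDerivAt_star_norm_le {f : ℝ → ℍ} {s a : ℝ} (hf : ∃ D : ℍ, HasDerivAt f D s ∧ ‖D‖ ≤ a) :
    ∃ D : ℍ, HasDerivAt (fun s => star (f s)) D s ∧ ‖D‖ ≤ a := by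
  obtain ⟨D, hD, hle⟩ := hf
  refine ⟨star D, ?_, by rw [Quaternion.norm_star]; exact hle⟩
  have h := (((hasDerivAt_re hD).const_mul 2).smul_const (1 : ℍ)).sub hD
  have e : (fun s => star (f s)) = fun s => (2 * (f s).re) • (1 : ℍ) - f s := funext fun s => FemtoTransferGap.TwoLattice.ConstTube.star_eq_two_re _
  rw [e, FemtoTransferGap.TwoLattice.ConstTube.star_eq_two_re]
  exact h

omit [NeZero L] in
/-- `d/ds (−f) = −f'` with the same norm bound. [folklore] -/
theorem hasDerivAt_neg_norm_le {f : ℝ → ℍ} {s a : ℝ} (hf : ∃ D : ℍ, HasDerivAt f D s ∧ ‖D‖ ≤ a) :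
    ∃ D : ℍ, HasDerivAt (fun s => -f s) D s ∧ ‖D‖ ≤ a := by
  obtain ⟨D, hD, hle⟩ := hf
  exact ⟨-D, hD.neg, by rw [norm_neg]; exact hle⟩

omit [NeZero L] in
/-- A real-valued term `c − k·re(w(s))`: derivative bound `|d/ds| ≤ |k|·(speed of w)`. [folklore] -/
theorem hasDerivAt_const_sub_mul_re {w : ℝ → ℍ} {s a : ℝ} (c k : ℝ) (hw : ∃ D : ℍ, HasDerivAt w D s ∧ ‖D‖ ≤ a) :
    ∃ d : ℝ, HasDerivAt (fun s => c - k * (w s).re) d s ∧ |d| ≤ |k| * a := by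
  obtain ⟨D, hD, hle⟩ := hw
  refine ⟨-(k * D.re), ?_, ?_⟩
  · have h := ((hasDerivAt_re hD).const_mul k).const_sub c
    simpa using h
  · rw [abs_neg, abs_mul]
    exact mul_le_mul_of_nonneg_left ((Literature.MathematicalPhysics.QuantumLattice.abs_re_le_norm D).trans hle) (abs_nonneg k)

/-! ## §2 The time coupling and the Wilson action along moving links -/

/-- ★ **`d/ds qTimeCoupling`**: links of norm `≤ 1` with speeds `≤ a` (first slot) and `≤ b` (second slot) give
`|d/ds Σ_e 2 re(U_e V̄_e)| ≤ |Edge|·2(a + b)`. [folklore] -/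
theorem hasDerivAt_qTimeCoupling {U V : ℝ → Edge 3 L → ℍ} {s a b : ℝ}
    (hU : ∀ e, ∃ D : ℍ, HasDerivAt (fun s => U s e) D s ∧ ‖D‖ ≤ a) (hV : ∀ e, ∃ D : ℍ, HasDerivAt (fun s => V s e) D s ∧ ‖D‖ ≤ b)
    (hU1 : ∀ e, ‖U s e‖ ≤ 1) (hV1 : ∀ e, ‖V s e‖ ≤ 1) :
    ∃ d : ℝ, HasDerivAt (fun s => qTimeCoupling (U s) (V s)) d s ∧ |d| ≤ Fintype.card (Edge 3 L) * (2 * (a + b)) := by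
  have hterm : ∀ e : Edge 3 L, ∃ d : ℝ, HasDerivAt (fun s => 2 * (U s e * star (V s e)).re) d s ∧ |d| ≤ 2 * (a + b) := by
    intro e
    have hw : ∃ D : ℍ, HasDerivAt (fun s => U s e * star (V s e)) D s ∧ ‖D‖ ≤ a + b :=
      exists_hasDerivAt_mul_norm_le (hU e) (hasDerivAt_star_norm_le (hV e)) (hU1 e) (by rw [Quaternion.norm_star]; exact hV1 e)
    obtain ⟨D, hD, hle⟩ := hw
    refine ⟨2 * D.re, (hasDerivAt_re hD).const_mul 2, ?_⟩
    rw [abs_mul, abs_two]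
    exact mul_le_mul_of_nonneg_left ((Literature.MathematicalPhysics.QuantumLattice.abs_re_le_norm D).trans hle) two_pos.le
  choose d hd using hterm
  refine ⟨∑ e, d e, ?_, ?_⟩
  · have h := HasDerivAt.fun_sum (u := Finset.univ) fun e _ => (hd e).1
    simpa [qTimeCoupling] using h
  · calc |∑ e, d e| ≤ ∑ e, |d e| := Finset.abs_sum_le_sum_abs _ _
      _ ≤ ∑ _e : Edge 3 L, 2 * (a + b) := Finset.sum_le_sum fun e _ => (hd e).2
      _ = Fintype.card (Edge 3 L) * (2 * (a + b)) := by rw [Finset.sum_const, Finset.card_univ, nsmul_eq_mul]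

omit [NeZero L] in
/-- The plaquette word of links of norm `≤ 1` and speed `≤ a` has speed `≤ 4a`. [folklore] -/
theorem hasDerivAt_qPlaq {U : ℝ → Edge 3 L → ℍ} {s a : ℝ} (hU : ∀ e, ∃ D : ℍ, HasDerivAt (fun s => U s e) D s ∧ ‖D‖ ≤ a) (hU1 : ∀ e, ‖U s e‖ ≤ 1)
    (x : Site 3 L) (i j : Fin 3) :
    ∃ D : ℍ, HasDerivAt (fun s => qPlaq (U s) x i j) D s ∧ ‖D‖ ≤ a + a + a + a := by
  have n2 : ‖U s (x, i) * U s (x.shift i, j)‖ ≤ 1 := (norm_mul_le _ _).trans (by nlinarith [hU1 (x, i), hU1 (x.shift i, j), norm_nonneg (U s (x, i))])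
  have n3 : ‖U s (x, i) * U s (x.shift i, j) * star (U s (x.shift j, i))‖ ≤ 1 :=
    (norm_mul_le _ _).trans (by rw [Quaternion.norm_star]; nlinarith [n2, hU1 (x.shift j, i), norm_nonneg (U s (x, i) * U s (x.shift i, j))])
  have h2 := exists_hasDerivAt_mul_norm_le (hU (x, i)) (hU (x.shift i, j)) (hU1 _) (hU1 _)
  have h3 := exists_hasDerivAt_mul_norm_le h2 (hasDerivAt_star_norm_le (hU (x.shift j, i))) n2 (by rw [Quaternion.norm_star]; exact hU1 _)
  have h4 := exists_hasDerivAt_mul_norm_le h3 (hasDerivAt_star_norm_le (hU (x, j))) n3 (by rw [Quaternion.norm_star]; exact hU1 _)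
  simpa only [qPlaq] using h4

/-- ★ **`d/ds qWilson`**: `|d/ds Σ_p (2 − 2 re(plaquette))| ≤ |Plaquette|·8a`. [folklore] -/
theorem hasDerivAt_qWilson {U : ℝ → Edge 3 L → ℍ} {s a : ℝ} (hU : ∀ e, ∃ D : ℍ, HasDerivAt (fun s => U s e) D s ∧ ‖D‖ ≤ a) (hU1 : ∀ e, ‖U s e‖ ≤ 1) :
    ∃ d : ℝ, HasDerivAt (fun s => qWilson (U s)) d s ∧ |d| ≤ Fintype.card (Plaquette 3 L) * (8 * a) := by
  have hterm : ∀ p : Plaquette 3 L, ∃ d : ℝ, HasDerivAt (fun s => 2 - 2 * (qPlaq (U s) p.1 p.2.1.1 p.2.1.2).re) d s ∧ |d| ≤ 8 * a := by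
    intro p
    obtain ⟨d, hd, hle⟩ := hasDerivAt_const_sub_mul_re 2 2 (hasDerivAt_qPlaq hU hU1 p.1 p.2.1.1 p.2.1.2)
    exact ⟨d, hd, hle.trans (by rw [abs_two]; linarith)⟩
  choose d hd using hterm
  refine ⟨∑ p, d p, ?_, ?_⟩
  · have h := HasDerivAt.fun_sum (u := Finset.univ) fun p _ => (hd p).1
    simpa [qWilson] using h
  · calc |∑ p, d p| ≤ ∑ p, |d p| := Finset.abs_sum_le_sum_abs _ _
      _ ≤ ∑ _p : Plaquette 3 L, 8 * a := Finset.sum_le_sum fun p _ => (hd p).2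
      _ = Fintype.card (Plaquette 3 L) * (8 * a) := by rw [Finset.sum_const, Finset.card_univ, nsmul_eq_mul]


/-! ## §3 The σ-glued seam and the whole deficit along a moving history -/

omit [NeZero L] in
/-- The σ-glued seam links along a moving history: norm `≤ 1` and speed `≤ 3M` (a word `g(x)·(±U₀(σe))·ḡ(x')`). [folklore] -/
theorem hasDerivAt_qSeam (z : Fin 3 → Bool) {Q : ℝ → (Fin (2 * L - 1 + 1) → Edge 3 L → ℍ) × (Site 3 L → ℍ)} {s M : ℝ}
    (h1 : ∀ i e, ∃ D : ℍ, HasDerivAt (fun s => (Q s).1 i e) D s ∧ ‖D‖ ≤ M) (h2 : ∀ x, ∃ D : ℍ, HasDerivAt (fun s => (Q s).2 x) D s ∧ ‖D‖ ≤ M)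
    (hn1 : ∀ i e, ‖(Q s).1 i e‖ ≤ 1) (hn2 : ∀ x, ‖(Q s).2 x‖ ≤ 1) (e : Edge 3 L) :
    (∃ D : ℍ, HasDerivAt (fun s => qSeam z (Q s) e) D s ∧ ‖D‖ ≤ M + M + M) ∧ ‖qSeam z (Q s) e‖ ≤ 1 := by
  -- the twisted, swapped slice-0 link as a path
  set e' : Edge 3 L := (sitePerm (L := L) (Equiv.swap (0 : Fin 3) 1).symm e.1, (Equiv.swap (0 : Fin 3) 1).symm e.2) with he'
  have hmid : (∃ D : ℍ, HasDerivAt (fun s => qTwist3 z (qSwap ((Q s).1 0)) e) D s ∧ ‖D‖ ≤ M) ∧ ‖qTwist3 z (qSwap ((Q s).1 0)) e‖ ≤ 1 := by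
    by_cases hc : e.1 e.2 = 0 ∧ z e.2 = true
    · have ef : (fun s => qTwist3 z (qSwap ((Q s).1 0)) e) = fun s => -((Q s).1 0 e') := by
        funext s; simp only [qTwist3, qSwap, hc, and_self, if_true, he']
      rw [ef]
      refine ⟨hasDerivAt_neg_norm_le (h1 0 e'), ?_⟩
      simp only [qTwist3, qSwap, hc, and_self, if_true, norm_neg]; exact hn1 0 _
    · have ef : (fun s => qTwist3 z (qSwap ((Q s).1 0)) e) = fun s => (Q s).1 0 e' := by
        funext s; simp only [qTwist3, qSwap, hc, if_false, he']
      rw [ef]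
      refine ⟨h1 0 e', ?_⟩
      simp only [qTwist3, qSwap, hc, if_false]; exact hn1 0 _
  obtain ⟨hmidD, hmidN⟩ := hmid
  have n2 : ‖(Q s).2 e.1 * qTwist3 z (qSwap ((Q s).1 0)) e‖ ≤ 1 :=
    (norm_mul_le _ _).trans (by nlinarith [hn2 e.1, hmidN, norm_nonneg ((Q s).2 e.1)])
  have hA := exists_hasDerivAt_mul_norm_le (h2 e.1) hmidD (hn2 e.1) hmidN
  have hB := exists_hasDerivAt_mul_norm_le hA (hasDerivAt_star_norm_le (h2 (e.1.shift e.2))) n2 (by rw [Quaternion.norm_star]; exact hn2 _)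
  refine ⟨by simpa only [qSeam, qGauge] using hB, ?_⟩
  show ‖(Q s).2 e.1 * qTwist3 z (qSwap ((Q s).1 0)) e * star ((Q s).2 (e.1.shift e.2))‖ ≤ 1
  exact (norm_mul_le _ _).trans (by rw [Quaternion.norm_star]; nlinarith [n2, hn2 (e.1.shift e.2), norm_nonneg ((Q s).2 e.1 * qTwist3 z (qSwap ((Q s).1 0)) e)])

/-- ★★★ **THE SPEED OF THE σ-GLUED DEFICIT ALONG A MOVING QUATERNION HISTORY**: if every link quaternion `(Q s).1 i e` and every seam quaternion
`(Q s).2 x` has norm `≤ 1` at `s` and a derivative of norm `≤ M` at `s` (`M ≥ 0`), then `s ↦ qDeficit z (Q s)` is differentiable at `s` with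
`|d/ds| ≤ 108·M·L⁴` (`2L` coupling terms `≤ 24ML³`, `2L` Wilson half-sums `≤ 48ML³`; ✓`card_edge_three`, ✓`card_plaquette_three`).  With M = 3 (parts 1–2:
letters `≤ 1`, links = words of `≤ 3` letters) this is the constant `C_L = 324·L⁴` of S-B. [cite: Luscher1983, §2] -/
theorem hasDerivAt_qDeficit_le (z : Fin 3 → Bool) {Q : ℝ → (Fin (2 * L - 1 + 1) → Edge 3 L → ℍ) × (Site 3 L → ℍ)} {s M : ℝ} (hM : 0 ≤ M)
    (h1 : ∀ i e, ∃ D : ℍ, HasDerivAt (fun s => (Q s).1 i e) D s ∧ ‖D‖ ≤ M) (h2 : ∀ x, ∃ D : ℍ, HasDerivAt (fun s => (Q s).2 x) D s ∧ ‖D‖ ≤ M)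
    (hn1 : ∀ i e, ‖(Q s).1 i e‖ ≤ 1) (hn2 : ∀ x, ‖(Q s).2 x‖ ≤ 1) :
    ∃ d : ℝ, HasDerivAt (fun s => qDeficit z (Q s)) d s ∧ |d| ≤ 108 * M * (L : ℝ) ^ 4 := by
  have hL1 : (1 : ℝ) ≤ L := by exact_mod_cast NeZero.one_le
  have hE : (Fintype.card (Edge 3 L) : ℝ) = 3 * (L : ℝ) ^ 3 := by rw [FemtoTransferGap.card_edge_three]; push_cast; ring
  have hP : (Fintype.card (Plaquette 3 L) : ℝ) = 3 * (L : ℝ) ^ 3 := by rw [FemtoTransferGap.card_plaquette_three]; push_cast; ring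
  have hS := fun e => (hasDerivAt_qSeam z h1 h2 hn1 hn2 e (s := s))
  -- the four blocks
  have hTC : ∀ i : Fin (2 * L - 1), ∃ d : ℝ, HasDerivAt (fun s => 6 * (L : ℝ) ^ 3 - qTimeCoupling ((Q s).1 i.castSucc) ((Q s).1 i.succ)) d s ∧
      |d| ≤ 12 * M * (L : ℝ) ^ 3 := by
    intro i
    obtain ⟨d, hd, hle⟩ := hasDerivAt_qTimeCoupling (fun e => h1 i.castSucc e) (fun e => h1 i.succ e) (fun e => hn1 _ e) (fun e => hn1 _ e)
    refine ⟨-d, by simpa using hd.const_sub (6 * (L : ℝ) ^ 3), ?_⟩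
    rw [abs_neg]; refine hle.trans ?_; rw [hE]; nlinarith
  have hTCs : ∃ d : ℝ, HasDerivAt (fun s => 6 * (L : ℝ) ^ 3 - qTimeCoupling ((Q s).1 (Fin.last (2 * L - 1))) (qSeam z (Q s))) d s ∧
      |d| ≤ 24 * M * (L : ℝ) ^ 3 := by
    obtain ⟨d, hd, hle⟩ := hasDerivAt_qTimeCoupling (fun e => h1 (Fin.last (2 * L - 1)) e) (fun e => (hS e).1) (fun e => hn1 _ e) (fun e => (hS e).2)
    refine ⟨-d, by simpa using hd.const_sub (6 * (L : ℝ) ^ 3), ?_⟩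
    rw [abs_neg]; refine hle.trans ?_; rw [hE]; nlinarith
  have hW : ∀ i : Fin (2 * L - 1), ∃ d : ℝ, HasDerivAt (fun s => (1 / 2 : ℝ) * (qWilson ((Q s).1 i.castSucc) + qWilson ((Q s).1 i.succ))) d s ∧
      |d| ≤ 24 * M * (L : ℝ) ^ 3 := by
    intro i
    obtain ⟨d₁, hd₁, hle₁⟩ := hasDerivAt_qWilson (fun e => h1 i.castSucc e) (fun e => hn1 _ e)
    obtain ⟨d₂, hd₂, hle₂⟩ := hasDerivAt_qWilson (fun e => h1 i.succ e) (fun e => hn1 _ e)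
    refine ⟨(1 / 2 : ℝ) * (d₁ + d₂), (hd₁.add hd₂).const_mul _, ?_⟩
    rw [hP] at hle₁ hle₂
    rw [abs_mul, abs_of_pos (by norm_num : (0 : ℝ) < 1 / 2)]
    have := abs_add_le d₁ d₂
    nlinarith
  have hWs : ∃ d : ℝ, HasDerivAt (fun s => (1 / 2 : ℝ) * (qWilson ((Q s).1 (Fin.last (2 * L - 1))) + qWilson (qSeam z (Q s)))) d s ∧
      |d| ≤ 48 * M * (L : ℝ) ^ 3 := by
    obtain ⟨d₁, hd₁, hle₁⟩ := hasDerivAt_qWilson (fun e => h1 (Fin.last (2 * L - 1)) e) (fun e => hn1 _ e)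
    obtain ⟨d₂, hd₂, hle₂⟩ := hasDerivAt_qWilson (U := fun s => qSeam z (Q s)) (fun e => (hS e).1) (fun e => (hS e).2)
    refine ⟨(1 / 2 : ℝ) * (d₁ + d₂), (hd₁.add hd₂).const_mul _, ?_⟩
    rw [hP] at hle₁ hle₂
    rw [abs_mul, abs_of_pos (by norm_num : (0 : ℝ) < 1 / 2)]
    have := abs_add_le d₁ d₂
    nlinarith
  choose dTC hdTC using hTC
  choose dW hdW using hW
  obtain ⟨dTCs, hdTCs, hleTCs⟩ := hTCs
  obtain ⟨dWs, hdWs, hleWs⟩ := hWs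
  refine ⟨(∑ i, dTC i) + dTCs + (∑ i, dW i) + dWs, ?_, ?_⟩
  · have hA := HasDerivAt.fun_sum (u := Finset.univ) fun i _ => (hdTC i).1
    have hC := HasDerivAt.fun_sum (u := Finset.univ) fun i _ => (hdW i).1
    have h := ((hA.add hdTCs).add hC).add hdWs
    simpa [qDeficit, Pi.add_def] using h
  · have hn : ((Fintype.card (Fin (2 * L - 1)) : ℝ)) = 2 * (L : ℝ) - 1 := by
      rw [Fintype.card_fin, Nat.cast_sub (by have := NeZero.one_le (n := L); omega), Nat.cast_mul]; push_cast; ring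
    have hA : |∑ i, dTC i| ≤ (2 * (L : ℝ) - 1) * (12 * M * (L : ℝ) ^ 3) := by
      calc |∑ i, dTC i| ≤ ∑ i, |dTC i| := Finset.abs_sum_le_sum_abs _ _
        _ ≤ ∑ _i : Fin (2 * L - 1), 12 * M * (L : ℝ) ^ 3 := Finset.sum_le_sum fun i _ => (hdTC i).2
        _ = (2 * (L : ℝ) - 1) * (12 * M * (L : ℝ) ^ 3) := by rw [Finset.sum_const, Finset.card_univ, nsmul_eq_mul, hn]
    have hC : |∑ i, dW i| ≤ (2 * (L : ℝ) - 1) * (24 * M * (L : ℝ) ^ 3) := by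
      calc |∑ i, dW i| ≤ ∑ i, |dW i| := Finset.abs_sum_le_sum_abs _ _
        _ ≤ ∑ _i : Fin (2 * L - 1), 24 * M * (L : ℝ) ^ 3 := Finset.sum_le_sum fun i _ => (hdW i).2
        _ = (2 * (L : ℝ) - 1) * (24 * M * (L : ℝ) ^ 3) := by rw [Finset.sum_const, Finset.card_univ, nsmul_eq_mul, hn]
    have h34 : M * (L : ℝ) ^ 3 ≤ M * (L : ℝ) ^ 4 := mul_le_mul_of_nonneg_left (pow_le_pow_right₀ hL1 (by norm_num)) hM
    have hML : 0 ≤ M * (L : ℝ) ^ 3 := by positivity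
    calc |(∑ i, dTC i) + dTCs + (∑ i, dW i) + dWs| ≤ |∑ i, dTC i| + |dTCs| + |∑ i, dW i| + |dWs| := by
          have := abs_add_le ((∑ i, dTC i) + dTCs + ∑ i, dW i) dWs
          have := abs_add_le ((∑ i, dTC i) + dTCs) (∑ i, dW i)
          have := abs_add_le (∑ i, dTC i) dTCs
          linarith
      _ ≤ (2 * (L : ℝ) - 1) * (12 * M * (L : ℝ) ^ 3) + 24 * M * (L : ℝ) ^ 3 + (2 * (L : ℝ) - 1) * (24 * M * (L : ℝ) ^ 3) + 48 * M * (L : ℝ) ^ 3 := by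
          linarith
      _ = 72 * (M * (L : ℝ) ^ 3 * L) + 36 * (M * (L : ℝ) ^ 3) := by ring
      _ ≤ 108 * M * (L : ℝ) ^ 4 := by nlinarith

end Summit.QuantumFields.YangMills.Theorems.SwapVirialDeficit.Gnomonic

end
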